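import Literature.AlgebraicGeometry.HodgeTheory.MotivatedClassesAlgebraic
import Literature.AlgebraicGeometry.HodgeTheory.MotivatedClassesAssembly
import Literature.AlgebraicGeometry.HodgeTheory.HardLefschetzNFoldHolds
import Literature.AlgebraicGeometry.HodgeTheory.TopDegreeClasses
import HarnessLib

/-!
# André 1996 Prop. 2.1 (ii), first inclusion — Lemme 1.3.2 for the pair `(*_η β, [Z])` BELOW the middle
# degree (singular cohomology of smooth projective complex varieties)

The companion files `…MotivatedPullbackFstReduction` and `…MotivatedPullbackFstCore` reduce the stub
(Y. André, *Pour une théorie inconditionnelle des motifs*, Publ. Math. IHÉS 83 (1996), Prop. 2.1 (ii),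
first inclusion) to `Voisin2003_cupProduct_algebraicClasses` and ONE span statement `h132` (André's
Lemme 1.3.2 for the pair `(*_η β, [Z])`): for `Z`, `W` smooth projective of dimensions `l`, `d`, a
polarisation class `η` of `W`, `b + b' = d` and `β ∈ Nᵇ H²ᵇ(W(ℂ); ℂ)`, the pulled-back involution
`pr_W^*(*_η β) ∈ H^{2b'}((Z ⊗ W)(ℂ); ℂ)` lies in the `ℂ`-span of the classes `γ ∪ *_θ δ` (`θ` a
polarisation class of `Z ⊗ W`, `γ`, `δ` algebraic on `Z ⊗ W`).

This file proves `h132` in the half `b ≤ b'` (the class `β` sits in degree `2b ≤ d = dim W`, where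
André's `*_η` IS the Lefschetz operator `L_η^{b'-b}`, §1.1), GRANTED the multiplicativity of
algebraic classes: then `*_η β = η^{b'-b} ∪ β` is algebraic (`η ∈ N¹`), so is its flat pull-back
`S = pr_W^*(*_η β)` (`map_snd_mem_supportedClasses`), and `S = S ∪ *_θ(θ^{l+d})` for ANY polarisation
class `θ` of `Z ⊗ W` (one exists: the hyperplane class of the hard Lefschetz theorem,
`nonempty_hardLefschetzNFold_holds`), `θ^{l+d} = L_θ^{l+d} 1` being a top-degree, hence algebraic,
class with `*_θ(L_θ^{l+d} 1) = 1`. So the genuinely missing input of the stub is the other half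
`b > b'`, where `*_η β = (L_η^{b-b'})⁻¹ β` is an INVERSE Lefschetz image: there
`S = *_θ(L_θ^{l+b-b'} S)` for the exterior-sum polarisation `θ = η_Z ⊠ 1 + 1 ⊠ η` of `Z ⊗ W`, with
`L_θ^{l+b-b'} S = Σᵢ C(l+b-b', i) η_Zⁱ ⊠ L_η^{l-i} β` algebraic (binomial expansion of
`L_θ(a ⊠ w) = L a ⊠ w + a ⊠ L w`) — which needs the hard Lefschetz property of the exterior sum
(André §1.3, the `𝔰𝔩₂`-equivariance of Künneth), absent on the real carriers.

* `lefschetzPowTo_mem_algebraicClasses_of_cupProduct` — `L_ηʲ(Nˡ H²ˡ) ⊆ N^{l+j}` for `η ∈ N¹`, granted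
  `Voisin2003_cupProduct_algebraicClasses` (iterate `N¹ ∪ Nˡ ⊆ N^{l+1}`);
* `lefschetzInvolution_mem_algebraicClasses_of_le` — `*_η β ∈ N^{b'}` for `β ∈ Nᵇ`, `b ≤ b'`;
* `lemma132_pair_of_le` — `h132` for `b ≤ b'`; `stub_motivatedPullbackFst_lemma132_of_le` — the same
  in implication form (registered sub-goal).

No definition and no named fact is introduced.

## References

* [Andre1996Motifs] Y. André, Pour une théorie inconditionnelle des motifs, Publ. Math. IHÉS 83
  (1996) 5–49: §1.1 (p. 10), §1.3 Lemme 1.3.2 (p. 13), Prop. 2.1 (ii) (p. 14) and proof (p. 15).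
* [VoisinHodgeI2002] C. Voisin, Hodge Theory and Complex Algebraic Geometry I, CUP 2002, §6.2.3,
  Thm. 6.25, Rem. 6.27.
* [VoisinHodgeII2003] C. Voisin, Hodge Theory and Complex Algebraic Geometry II, CUP 2003, §9.2.4
  Prop. 9.20, §10.2.3 proof of Prop. 10.26.
* [Hartshorne1977] R. Hartshorne, Algebraic Geometry, GTM 52, III Prop. 9.5.

Provenance: Literature home (family `hodge`, layer `Literature/AlgebraicGeometry/HodgeTheory`, namespace
`Literature.AlgebraicGeometry.HodgeTheory.MotivatedPullback`) of the Summits-side `Theorems/HeckePrymWeilSummitOffWeilSectorMotivatedPullbackFstBelowMiddle` (cell `pub-hodge-ring2` ∕ route files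
`HeckePrymWeilSummitOffWeilSector*`, the tree's derivation of André 1996 Prop. 2.1 (ii): motivated classes are stable
under pull-back), which `Literature/` may not import; theorems only, no named fact, no definition. Nothing here bears
on `HC_CM`; no case of the Hodge conjecture is proved. Lane `lit-hodgefound`, seat p20.
-/

noncomputable section

open _root_.CategoryTheory _root_.AlgebraicGeometry MonoidalCategory CartesianMonoidalCategory
open Literature.AlgebraicTopology.SingularHomology Literature.Geometry.Kaehler
open Literature.AlgebraicGeometry Literature.AlgebraicGeometry.Motives
  Literature.AlgebraicGeometry.HodgeTheory

namespace Literature.AlgebraicGeometry.HodgeTheory.MotivatedPullback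

/-- Degree-and-codimension transport for iterated Lefschetz operators inside the support
filtration: the membership `Lʲ c ∈ Nʳ Hᵐ` depends neither on how the target degree `m = k + 2j` is
written nor on how the codimension `r` is written. [folklore] [cite: Andre1996Motifs, Prop. 2.1 (ii) (p. 14) and its proof (p. 15), auxiliary step] -/
theorem lefschetzPowTo_mem_supportedClasses_congr {V : SchemeOver ℂ} (κ : complexBetti V 2)
    {j k m₁ m₂ r₁ r₂ : ℕ} (h₁ : k + 2 * j = m₁) (h₂ : k + 2 * j = m₂) (hr : r₁ = r₂)
    (c : complexBetti V k) :
    lefschetzPowTo κ j k m₁ h₁ c ∈ supportedClasses V m₁ r₁ ↔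
      lefschetzPowTo κ j k m₂ h₂ c ∈ supportedClasses V m₂ r₂ := by
  subst h₁ h₂ hr
  exact Iff.rfl

/-- **`L_ηʲ(Nˡ H²ˡ) ⊆ N^{l+j} H^{2(l+j)}` for a class `η ∈ N¹ H²`**, granted the multiplicativity of
algebraic classes (`Voisin2003_cupProduct_algebraicClasses`, Voisin II Prop. 9.20:
`[H] ∪ [Z] = [H · Z]`): iterate `N¹ ∪ Nˡ ⊆ N^{l+1}` (the tree's `HardLefschetzNFold.L_mem_algebraicClasses_of_mem`
for an arbitrary divisor class instead of the hyperplane class). [cite: VoisinHodgeII2003, §9.2.4 Prop. 9.20] -/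
theorem lefschetzPowTo_mem_algebraicClasses_of_cupProduct (hV : Voisin2003_cupProduct_algebraicClasses)
    {d : ℕ} {W : SchemeOver ℂ} (hW : IsSmoothProjective d W) {η : complexBetti W 2}
    (hη : η ∈ algebraicClasses W 1) :
    ∀ (j l : ℕ) (hm : 2 * l + 2 * j = 2 * (l + j)) {c : complexBetti W (2 * l)},
      c ∈ algebraicClasses W l → lefschetzPowTo η j (2 * l) (2 * (l + j)) hm c ∈ algebraicClasses W (l + j)
  | 0, l, hm, c, hc => by
    have h0 : lefschetzPowTo η 0 (2 * l) (2 * (l + 0)) hm c = c := rfl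
    rw [h0]
    exact hc
  | j + 1, l, hm, c, hc => by
    rw [lefschetzPowTo_succ_apply η j (2 * l) (2 * (l + j)) (2 * (l + (j + 1))) (by omega) hm (by omega),
      lefschetzOperator_apply]
    have ih := lefschetzPowTo_mem_algebraicClasses_of_cupProduct hV hW hη j l (by omega) hc
    exact (cupProduct_mem_supportedClasses_congr (two_mul_add_two_mul 1 (l + j)) _
      (show 1 + (l + j) = l + (j + 1) by omega) η _).1 (hV hW hη ih)

/-- **Below the middle degree `*_η` of an algebraic class is algebraic**, granted the multiplicativity
of algebraic classes: for a polarisation class `η` of the smooth projective `d`-fold `W` (`η ∈ N¹`),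
`β ∈ Nᵇ H²ᵇ(W(ℂ); ℂ)` and `b ≤ b'` (`b + b' = d`), `*_η β = L_η^{b'-b} β ∈ N^{b'} H^{2b'}` ("donnée en
chaque degré par l'isomorphisme de Lefschetz", André §1.1/§0.2: below the middle `*_L = L^{d-2b}`,
the tree's `lefschetzInvolution_apply_of_le`). [cite: Andre1996Motifs, §0.2 (p. 7) and §1.1 (p. 10)]
[cite: VoisinHodgeII2003, §9.2.4 Prop. 9.20] -/
theorem lefschetzInvolution_mem_algebraicClasses_of_le (hV : Voisin2003_cupProduct_algebraicClasses)
    {d : ℕ} {W : SchemeOver ℂ} (hW : IsSmoothProjective d W) {η : complexBetti W 2}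
    (hη : IsPolarizationClass d W η) {b b' : ℕ} (hbb' : b + b' = d) (hle : b ≤ b')
    (h₄ : 2 * b + 2 * b' = 2 * d) {β : complexBetti W (2 * b)} (hβ : β ∈ algebraicClasses W b) :
    lefschetzInvolution hη.hasHardLefschetz h₄ β ∈ algebraicClasses W b' := by
  obtain ⟨j, rfl⟩ : ∃ j, b' = b + j := ⟨b' - b, by omega⟩
  have key : ∀ (m : ℕ) (hm : 2 * b + 2 * j = m) (h₄' : 2 * b + m = 2 * d),
      lefschetzInvolution hη.hasHardLefschetz h₄' β ∈ supportedClasses W m (b + j) := by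
    rintro m rfl h₄'
    rw [lefschetzInvolution_apply_of_le hη.hasHardLefschetz (a := 2 * b) (j := j) (by omega) h₄' β,
      ← lefschetzPowTo_eq_lefschetzPow]
    exact (lefschetzPowTo_mem_supportedClasses_congr η (by omega) rfl rfl β).1
      (lefschetzPowTo_mem_algebraicClasses_of_cupProduct hV hW hη.mem_algebraicClasses j b (by omega) hβ)
  exact key (2 * (b + j)) (by omega) h₄

/-- `*_θ (L_θʲ x) = x` above the middle degree, with an explicit target degree for `L_θʲ`
(`lefschetzInvolution_lefschetzPow` of the tree, transported). [cite: Andre1996Motifs, §0.2 (p. 7)] -/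
theorem lefschetzInvolution_lefschetzPowTo {V : SchemeOver ℂ} {θ : complexBetti V 2} {D : ℕ}
    (hL : HasHardLefschetzProperty θ D) {b₀ j : ℕ} (hj : b₀ + j = D) :
    ∀ (m : ℕ) (hm : b₀ + 2 * j = m) (hab : m + b₀ = 2 * D) (x : complexBetti V b₀),
      lefschetzInvolution hL hab (lefschetzPowTo θ j b₀ m hm x) = x := by
  rintro m rfl hab x
  exact lefschetzInvolution_lefschetzPow hL hj hab x

/-- **Lemme 1.3.2 for the pair `(*_η β, [Z])`, below the middle degree** (the half `b ≤ b'` of the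
hypothesis `h132` of `stub_motivatedPullbackFst_core_of_lemma132`), granted the multiplicativity of
algebraic classes: for `Z`, `W` smooth projective of dimensions `l`, `d`, a polarisation class `η` of
`W`, `b + b' = d` with `b ≤ b'`, and `β ∈ Nᵇ H²ᵇ(W(ℂ); ℂ)`, the class `S = pr_W^*(*_η β)` lies in the
span of the classes `γ ∪ *_θ δ`: indeed `S = S ∪ *_θ(L_θ^{l+d} 1)` with `θ` the hyperplane class of the
hard Lefschetz theorem on `Z ⊗ W` (`nonempty_hardLefschetzNFold_holds`, Voisin I Thm. 6.25), `S`
algebraic (`lefschetzInvolution_mem_algebraicClasses_of_le` and flat pull-back,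
`map_snd_mem_supportedClasses`), `L_θ^{l+d} 1 ∈ H^{2(l+d)}` algebraic
(`HardLefschetzNFold.L_mem_algebraicClasses_of_mem`) and `*_θ(L_θ^{l+d} 1) = 1`.
[cite: Andre1996Motifs, Lemme 1.3.2 (p. 13) and proof of Prop. 2.1 (p. 15)]
[cite: VoisinHodgeI2002, Thm. 6.25 and Rem. 6.27] [cite: Hartshorne1977, III Prop. 9.5] -/
theorem lemma132_pair_of_le (hV : Voisin2003_cupProduct_algebraicClasses) ⦃l d : ℕ⦄
    ⦃Z W : SchemeOver ℂ⦄ (hZ : IsSmoothProjective l Z) (hW : IsSmoothProjective d W)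
    ⦃η : complexBetti W 2⦄ (hη : IsPolarizationClass d W η) ⦃b b' : ℕ⦄ (hbb' : b + b' = d)
    (hle : b ≤ b') ⦃β : complexBetti W (2 * b)⦄ (hβ : β ∈ algebraicClasses W b) :
    complexBetti.map (snd Z W) (2 * b')
        (lefschetzInvolution hη.hasHardLefschetz (show 2 * b + 2 * b' = 2 * d by omega) β) ∈
      Submodule.span ℂ {s : complexBetti (Z ⊗ W) (2 * b') |
        ∃ (θ : complexBetti (Z ⊗ W) 2) (hθ : IsPolarizationClass (l + d) (Z ⊗ W) θ) (c e e' : ℕ)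
          (_ : c + e' = b') (_ : e + e' = l + d) (γ : complexBetti (Z ⊗ W) (2 * c))
          (δ : complexBetti (Z ⊗ W) (2 * e)),
          γ ∈ algebraicClasses (Z ⊗ W) c ∧ δ ∈ algebraicClasses (Z ⊗ W) e ∧
            s = cupProduct (show 2 * c + 2 * e' = 2 * b' by omega) γ
              (lefschetzInvolution hθ.hasHardLefschetz
                (show 2 * e + 2 * e' = 2 * (l + d) by omega) δ)} := by
  have hZW : IsSmoothProjective (l + d) (Z ⊗ W) := IsSmoothProjective.tensor_holds hZ hW
  obtain ⟨Λ⟩ := nonempty_hardLefschetzNFold_holds (l + d) (Z ⊗ W) hZW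
  refine Submodule.subset_span ?_
  -- `S` is algebraic
  have hS : complexBetti.map (snd Z W) (2 * b')
      (lefschetzInvolution hη.hasHardLefschetz (show 2 * b + 2 * b' = 2 * d by omega) β) ∈
      algebraicClasses (Z ⊗ W) b' :=
    map_snd_mem_supportedClasses hZ hW (lefschetzInvolution_mem_algebraicClasses_of_le hV hW hη hbb' hle _ hβ)
  -- `δ = L_θ^{l+d} 1`, a top-degree algebraic class with `*_θ δ = 1`
  set δ := lefschetzPowTo Λ.hyperplaneClass (l + d) 0 (2 * (l + d)) (by omega)
    (singularCohomology.one ℂ (ComplexPoints (Z ⊗ W))) with hδ_def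
  have hδ : δ ∈ algebraicClasses (Z ⊗ W) (l + d) := by
    have h := Λ.L_mem_algebraicClasses_of_mem (l + d) 0 (by omega)
      (c := singularCohomology.one ℂ (ComplexPoints (Z ⊗ W))) (by rw [algebraicClasses_zero]; trivial)
    exact (lefschetzPowTo_mem_supportedClasses_congr Λ.hyperplaneClass _ _ (Nat.zero_add _) _).1 h
  have hstar : lefschetzInvolution Λ.hasHardLefschetz (show 2 * (l + d) + 2 * 0 = 2 * (l + d) by omega) δ =
      singularCohomology.one ℂ (ComplexPoints (Z ⊗ W)) :=
    lefschetzInvolution_lefschetzPowTo Λ.hasHardLefschetz (Nat.zero_add _) _ _ _ _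
  refine ⟨Λ.hyperplaneClass, Λ.isPolarizationClass, b', l + d, 0, Nat.add_zero _, Nat.add_zero _, _, δ,
    hS, hδ, ?_⟩
  rw [hstar, cupProduct_one]

end Literature.AlgebraicGeometry.HodgeTheory.MotivatedPullback

end
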